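import Summits.ABC.IUTFork.Cor312Ind3Real
import Summits.ABC.IUTFork.Thm311Real3
import Summits.ABC.IUTFork.Thm311RealLog
import HarnessLib

/-!
# [IUTchIII] Theorem 3.11 (ii) at the REAL carriers: the log-link iterates on the local units, (Ind3)
# with NO iterate hypothesis at finite places, and the typed (ii) for the strictified real lattice situation

Record file (D-0012) of the abc-iut cell (D-0067 discharge wave 4, seat abc-iut-w4-d087; CONE-BOARD node
`IUTchIII:Thm3.11(ii)` = abc-iut-c312-1's NAMED PIECE «Thm3.11(ii)-strict», HOME/INBOX 2026-08-25T23:25:15Z,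
part 2 of 2 — part 1 is the generic `Thm311PartIIDischarge.lean`); TAKES NO SIDE on [IUTchIII] Cor. 3.12.
S. Mochizuki, *Inter-universal Teichmüller theory III*, kurims manuscript (May 2020): Thm. 3.11 (ii) and
(Ind3) pp. 155–156, Prop. 3.5 (ii) (a) pp. 104–105, Rmk. 1.1.1 (i) p. 28 ("iterates … are to be understood
as being defined only on the [local] units that appear in the domains"), Rmk. 1.2.2 (i), (iii) pp. 36–37
("upper semi-commutativity"). [claim: Mochizuki2012, status: disputed]

abc-iut-c312-12's `Cor312Ind3Real.lean` (TEAM B row B-3) proves (Ind3) for columns over abc-iut-c312-5's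
real carriers `K_v` (`Thm311Real.lean`: `Carrier`, `shell logv`, `Real.unitsSet`) whose transported images are
pure-tensor images of per-place component sets, PROVING the un-iterated containments from the law
`Real.LogvLaw logv` (`O_v ⊆ I_v`) and leaving the ITERATE components' containments as named hypotheses
`hUiterNon` / `hUiterArc`. THIS FILE DISCHARGES `hUiterNon` — for EVERY logarithm binder `logv : Real.PadicLogs F`
— by DEFINING the iterates of the log-link on the local units of `K_v` honestly: every defined value of a
`(k+1)`-st iterate is `log_v` of a unit, hence lies in `log_v(O_v^×) ⊆ I_v` (c312-5's `Real.log_mem_shell`).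
* §1 `Real.unitOfMem`, `Real.logStep` (ONE log-link step at a finite place as a PARTIAL map on `K_v`, defined
  exactly on `O_v^×`, value `log_v`; Def. 1.1 (i) / Rmk. 1.1.1 (i)), `Real.logIter` (its `m'`-th iterate),
  `Real.iterImage` (image of the `m'`-th iterate on the units where defined — the per-place component set of
  Prop. 3.5 (ii) (a) (2)); PROVED: `iterImage_zero` (`= O_v^×`), `iterImage_succ_subset_range_log`,
  `iterImage_succ_subset_shell` (**upper semi-commutativity at the real carriers**, any `logv`), `iterImage_one`
  (the first iterate is defined on ALL of `O_v^×` with image `log_v(O_v^×)` — non-vacuity).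
* §2 `Real.iterUnits logv Uarc m'` — the per-place family: `iterImage` at finite places; at archimedean places
  the BINDER `Uarc m' w ⊆ K_w` (the chosen bounded subsets of the radius-`π` ball of Prop. 3.5 (ii) (b);
  one-factor witnesses: abc-iut-L6-t4's `prop35ii_b_arcExp`), asked to start at `{‖a‖ = 1}` and to lie in the ball.
* §3 `Column.ind3_logShells_of_iterUnits` — **(Ind3) HOLDS** for every column over `Real.logShells X logv Aut Ism …`
  (ANY automorphism binders, e.g. the Dupuy–Hilado instance `logShellsDH`) whose unit-group images are the
  pure-tensor images (`LogShells.tprodImages`, c312-12) of `iterUnits` and whose radius-`π` balls are those of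
  the shells, under the law and `L.shellPk ⊆ D.shellPk`: NO nonarchimedean iterate hypothesis remains.
* §4 `Real.partII_ofShells_of_iterUnits` — **the typed Thm. 3.11 (ii) (`LatticeSituation.PartII`) HOLDS** for
  "the situation of Theorem 3.11" built over the real carriers (`LatticeSituation.ofShells`, strictified
  reading: each column's Frobenius-like binders := the coric data of its line, Kummer = identity — c312-5's
  vacuity audit `partII_iff_ind3_of_coric`) with these images, given the law, the archimedean binder
  conditions, and `L.shellPk ⊆ archPk` at archimedean `v_ℚ`; `Real.partII_ofShells_analyticLogv` —
  UNCONDITIONAL IN THE LOGARITHM at `logv := Real.analyticLogv F` (c312-5's `logvLaw_analyticLogv`).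

HONEST FRAMING (as in part 1, from the typer's hand-off): this is (ii) in the STRICTIFIED reading; the content
of (ii) beyond (Ind3)-as-containment (Kummer isomorphisms as non-identity maps of monoids, [IUTchII] Cor. 4.6
(iii) / 4.8; log-volume compatibility of two different volumes) is not captured by the typing and not
discharged here; the archimedean iterate components remain a binder constrained to the ball. New definitions:
the four of §1 and `iterUnits` — constructions on landed carriers, no new `Prop` fact. typed ≠ endorsed. -/

noncomputable section

open Set

namespace Summit.ABC.IUTFork.Thm311
namespace Real

open NumberField IsDedekindDomain Literature.IUT.LogVolume Literature.IUT.LogThetaLattice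

variable {F : Type} [Field F] [NumberField F]

/-! ## §1 The log-link and its iterates on the local units of `K_v`, `v` finite -/

/-- The unit of the valuation ring `O_v` underlying an element of the honest unit set
`Real.unitsSet (.inr v) = {x ≠ 0 | x, x⁻¹ ∈ O_v}` ([IUTchIII] Rmk. 1.2.2 (i) "`O_k^×`"). [folklore] -/
def unitOfMem {v : HeightOneSpectrum (𝓞 F)} {x : Carrier (.inr v : Place F)}
    (h : x ∈ unitsSet (.inr v : Place F)) : (↥(integers (F := F) v))ˣ where
  val := ⟨x, h.2.1⟩
  inv := ⟨x⁻¹, h.2.2⟩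
  val_inv := Subtype.ext (mul_inv_cancel₀ h.1)
  inv_val := Subtype.ext (inv_mul_cancel₀ h.1)

/-- The unit underlying `x` is `x`. [folklore] -/
@[simp] theorem coe_unitOfMem {v : HeightOneSpectrum (𝓞 F)} {x : Carrier (.inr v : Place F)}
    (h : x ∈ unitsSet (.inr v : Place F)) :
    ((unitOfMem h : ↥(integers (F := F) v)) : Carrier (.inr v : Place F)) = x := rfl

/-- A unit of `O_v`, read in `K_v`, lies in the honest unit set. [folklore] -/
theorem coe_unit_mem_unitsSet {v : HeightOneSpectrum (𝓞 F)} (u : (↥(integers (F := F) v))ˣ) :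
    ((u : ↥(integers (F := F) v)) : Carrier (.inr v : Place F)) ∈ unitsSet (.inr v : Place F) := by
  have hmul : ((u : ↥(integers (F := F) v)) : Carrier (.inr v : Place F)) *
      ((u⁻¹ : (↥(integers (F := F) v))ˣ) : ↥(integers (F := F) v)) = 1 := by
    rw [← Subring.coe_mul, Units.mul_inv]
    rfl
  have hne : ((u : ↥(integers (F := F) v)) : Carrier (.inr v : Place F)) ≠ 0 := by
    intro h0
    rw [h0, zero_mul] at hmul
    exact zero_ne_one hmul
  refine ⟨hne, (u : ↥(integers (F := F) v)).2, ?_⟩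
  have hinv : ((u : ↥(integers (F := F) v)) : Carrier (.inr v : Place F))⁻¹ =
      ((u⁻¹ : (↥(integers (F := F) v))ˣ) : ↥(integers (F := F) v)) :=
    inv_eq_of_mul_eq_one_right hmul
  rw [hinv]
  exact ((u⁻¹ : (↥(integers (F := F) v))ˣ) : ↥(integers (F := F) v)).2

/-- The unit underlying the image of a unit is that unit. [folklore] -/
theorem unitOfMem_coe {v : HeightOneSpectrum (𝓞 F)} (u : (↥(integers (F := F) v))ˣ) :
    unitOfMem (coe_unit_mem_unitsSet u) = u :=
  Units.ext (Subtype.ext rfl)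

open Classical in
/-- **ONE STEP of the log-link at a finite place `v`, as a PARTIAL map on `K_v`** ([IUTchIII] Def. 1.1 (i):
the `p_v`-adic logarithm `log_v : O_v^× → K_v`; Rmk. 1.1.1 (i): defined only on the units): `x ↦ log_v(x)` if
`x ∈ O_v^×`, undefined (`none`) otherwise; over the logarithm binder `logv : Real.PadicLogs F`.
[claim: Mochizuki2012, status: disputed] -/
def logStep (logv : PadicLogs F) (v : HeightOneSpectrum (𝓞 F)) (x : Carrier (.inr v : Place F)) :
    Option (Carrier (.inr v : Place F)) :=
  if h : x ∈ unitsSet (.inr v : Place F) then some (logv v (Additive.ofMul (unitOfMem h))) else none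

/-- **The `m'`-th ITERATE of the log-link at a finite place** as a partial map on `K_v` ([IUTchIII] Rmk.
1.1.1 (i): "the `n`-th iterate … defined only on the [local] units that appear in the domains"): `m' = 0`
the identity; `m' = k + 1` = one more step applied where the `k`-th iterate is defined and its value is a
unit. [claim: Mochizuki2012, status: disputed] -/
def logIter (logv : PadicLogs F) (v : HeightOneSpectrum (𝓞 F)) (m' : ℕ) (x : Carrier (.inr v : Place F)) :
    Option (Carrier (.inr v : Place F)) :=
  (fun o : Option (Carrier (.inr v : Place F)) => o.bind (logStep logv v))^[m'] (some x)

/-- **The image of the `m'`-th iterate of the log-link on the units where it is defined** — the per-place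
component set of [IUTchIII] Prop. 3.5 (ii) (a) (2) ("the pre-composite of these Kummer isomorphisms with
the `m'`-th iterates … of the log-links") at a finite place. [claim: Mochizuki2012, status: disputed] -/
def iterImage (logv : PadicLogs F) (v : HeightOneSpectrum (𝓞 F)) (m' : ℕ) :
    Set (Carrier (.inr v : Place F)) :=
  {y | ∃ x ∈ unitsSet (.inr v : Place F), logIter logv v m' x = some y}

variable (logv : PadicLogs F) (v : HeightOneSpectrum (𝓞 F))

/-- The step is defined on a unit, with value `log_v` of it. [folklore] -/
theorem logStep_of_mem {x : Carrier (.inr v : Place F)} (h : x ∈ unitsSet (.inr v : Place F)) :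
    logStep logv v x = some (logv v (Additive.ofMul (unitOfMem h))) := by
  classical
  exact dif_pos h

/-- Every defined value of the step is `log_v` of a unit of `O_v`. [folklore] -/
theorem logStep_eq_some {x y : Carrier (.inr v : Place F)} (h : logStep logv v x = some y) :
    ∃ u : (↥(integers (F := F) v))ˣ, y = logv v (Additive.ofMul u) := by
  classical
  unfold logStep at h
  split_ifs at h with hx
  exact ⟨unitOfMem hx, (Option.some.inj h).symm⟩

/-- The `0`-th iterate is the identity. [folklore] -/
@[simp] theorem logIter_zero (x : Carrier (.inr v : Place F)) : logIter logv v 0 x = some x := rfl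

/-- The `(k+1)`-st iterate is the step applied to the `k`-th (where defined). [folklore] -/
theorem logIter_succ (k : ℕ) (x : Carrier (.inr v : Place F)) :
    logIter logv v (k + 1) x = (logIter logv v k x).bind (logStep logv v) :=
  Function.iterate_succ_apply' _ _ _

/-- The image of the `0`-th iterate on the units is the unit set `O_v^×` (Prop. 3.5 (ii) (a) (1)).
[claim: Mochizuki2012, status: disputed] -/
theorem iterImage_zero : iterImage logv v 0 = unitsSet (.inr v : Place F) := by
  ext y
  constructor
  · rintro ⟨x, hx, h⟩
    rw [logIter_zero, Option.some.injEq] at h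
    exact h ▸ hx
  · intro hy
    exact ⟨y, hy, rfl⟩

/-- Every defined value of a `(k+1)`-st iterate of the log-link on the units is `log_v` of a unit of `O_v`.
[claim: Mochizuki2012, status: disputed] -/
theorem iterImage_succ_subset_range_log (k : ℕ) :
    iterImage logv v (k + 1) ⊆
      Set.range fun u : (↥(integers (F := F) v))ˣ => logv v (Additive.ofMul u) := by
  rintro y ⟨x, -, h⟩
  rw [logIter_succ] at h
  obtain ⟨z, -, hz⟩ := Option.bind_eq_some_iff.1 h
  obtain ⟨u, rfl⟩ := logStep_eq_some logv v hz
  exact ⟨u, rfl⟩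

/-- **UPPER SEMI-COMMUTATIVITY AT THE REAL CARRIERS** ([IUTchIII] Rmk. 1.2.2 (iii) p. 37; the per-place
content of Prop. 3.5 (ii) (a) (2)): for every `m' ≥ 1` the image of the `m'`-th iterate of the log-link on
the portion of `O_v^×` where it is defined lies in the log-shell `I_v = (p_v^*)⁻¹·log_v(O_v^×)` — for EVERY
logarithm binder `logv` (abc-iut-c312-5's `Real.log_mem_shell`). [claim: Mochizuki2012, status: disputed] -/
theorem iterImage_succ_subset_shell (k : ℕ) : iterImage logv v (k + 1) ⊆ shell logv (.inr v) := by
  refine (iterImage_succ_subset_range_log logv v k).trans ?_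
  rintro _ ⟨u, rfl⟩
  exact log_mem_shell logv v u

/-- NON-VACUITY: the FIRST iterate of the log-link is defined on all of `O_v^×`, with image exactly
`log_v(O_v^×)`. [claim: Mochizuki2012, status: disputed] -/
theorem iterImage_one :
    iterImage logv v 1 = Set.range fun u : (↥(integers (F := F) v))ˣ => logv v (Additive.ofMul u) := by
  refine Set.Subset.antisymm (iterImage_succ_subset_range_log logv v 0) ?_
  rintro _ ⟨u, rfl⟩
  refine ⟨_, coe_unit_mem_unitsSet u, ?_⟩
  show logStep logv v _ = _
  rw [logStep_of_mem logv v (coe_unit_mem_unitsSet u), unitOfMem_coe]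

/-! ## §2 The per-place family of component sets -/

/-- **The per-place component sets of [IUTchIII] Prop. 3.5 (ii) (a)(b) at the real carriers**: at a finite
place `v`, the image `iterImage logv v m'` of the `m'`-th iterate of the log-link on the units (`m' = 0`: the
units themselves); at an archimedean place `w`, the BINDER `Uarc m' w ⊆ K_w` — the chosen bounded subsets of
the radius-`π` ball of Prop. 3.5 (ii) (b) (one-factor witnesses: abc-iut-L6-t4's `prop35ii_b_arcExp`).
[claim: Mochizuki2012, status: disputed] -/
def iterUnits (logv : PadicLogs F) (Uarc : ℕ → ∀ w : InfinitePlace F, Set (Carrier (.inl w : Place F)))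
    (m' : ℕ) : ∀ x : Place F, Set (Carrier x)
  | .inl w => Uarc m' w
  | .inr v => iterImage logv v m'

variable (Uarc : ℕ → ∀ w : InfinitePlace F, Set (Carrier (.inl w : Place F)))

/-- At `m' = 0` the family is the honest unit set at every place (given that the archimedean binder starts
there). [claim: Mochizuki2012, status: disputed] -/
theorem iterUnits_zero (hU0 : ∀ w, Uarc 0 w = unitsSet (.inl w : Place F)) :
    ∀ x : Place F, iterUnits logv Uarc 0 x = unitsSet x
  | .inl w => hU0 w
  | .inr v => iterImage_zero logv v

/-- For `m' ≥ 1` the family lies in the shell at every place: PROVED at finite places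
(`iterImage_succ_subset_shell`), the binder's condition at archimedean ones. [claim: Mochizuki2012, status: disputed] -/
theorem iterUnits_succ_subset_shell (hUs : ∀ k w, Uarc (k + 1) w ⊆ shell logv (.inl w)) (k : ℕ) :
    ∀ x : Place F, iterUnits logv Uarc (k + 1) x ⊆ shell logv x
  | .inl w => hUs k w
  | .inr v => iterImage_succ_subset_shell logv v k

/-- Under the law `O_v ⊆ I_v`, the family lies in the shell at every place and every `m'`.
[claim: Mochizuki2012, status: disputed] -/
theorem iterUnits_subset_shell {logv : PadicLogs F} (hlaw : LogvLaw logv)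
    (Uarc : ℕ → ∀ w : InfinitePlace F, Set (Carrier (.inl w : Place F)))
    (hU0 : ∀ w, Uarc 0 w = unitsSet (.inl w : Place F))
    (hUs : ∀ k w, Uarc (k + 1) w ⊆ shell logv (.inl w)) (m' : ℕ) (x : Place F) :
    iterUnits logv Uarc m' x ⊆ shell logv x := by
  rcases m' with _ | k
  · rw [iterUnits_zero logv Uarc hU0 x]
    exact unitsSet_subset_shell hlaw x
  · exact iterUnits_succ_subset_shell logv Uarc hUs k x

end Real

/-! ## §3 (Ind3) over the real carriers with NO nonarchimedean iterate hypothesis -/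

namespace Column

open Real NumberField IsDedekindDomain Literature.IUT.LogVolume Literature.IUT.LogThetaLattice

variable {F : Type} [Field F] [NumberField F]

/-- **[IUTchIII] Thm. 3.11 (ii) (Ind3) AT THE REAL CARRIERS, nonarchimedean iterates DISCHARGED** (p. 156
← Prop. 3.5 (ii) (a), (b) pp. 104–105): for every column over abc-iut-c312-5's `Real.logShells X logv Aut Ism …`
(any automorphism binders; the Dupuy–Hilado instance `logShellsDH` included) whose transported unit-group
images at `(m, m')` are the pure-tensor images of the per-place sets `Real.iterUnits logv Uarc m'` (finite
places: the images of the `m'`-th iterates of the log-link on the units where defined; archimedean: the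
binder) and whose radius-`π` balls are the pure-tensor images of the shells, (Ind3) HOLDS under the law
`O_v ⊆ I_v` and `L.shellPk ⊆ D.shellPk` — the un-iterated containments by abc-iut-c312-12's
`unitsSet_subset_shell`, the nonarchimedean ITERATE containments by `Real.iterImage_succ_subset_shell`
(any `logv`), the archimedean ones by the binder's condition. [claim: Mochizuki2012, status: disputed] -/
theorem ind3_logShells_of_iterUnits (X : PilotData F) (logv : PadicLogs F) (hlaw : LogvLaw logv)
    (Aut Ism : ∀ x : Place F, Set (Carrier x ≃ₗ[ℚ] Carrier x))
    (hAut : ∀ x, LinearEquiv.refl ℚ (Carrier x) ∈ Aut x) (hIsm : ∀ x, LinearEquiv.refl ℚ (Carrier x) ∈ Ism x)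
    (Uarc : ℕ → ∀ w : InfinitePlace F, Set (Carrier (.inl w : Place F)))
    (hU0 : ∀ w, Uarc 0 w = unitsSet (.inl w : Place F))
    (hUs : ∀ k w, Uarc (k + 1) w ⊆ shell logv (.inl w))
    (C : Column (logShells X logv Aut Ism hAut hIsm)) (D : MRData (logShells X logv Aut Ism hAut hIsm))
    (hpk : ∀ (j : (thetaIndex X).Label) (vQ : (thetaIndex X).VQ),
      ((logShells X logv Aut Ism hAut hIsm).shellPk j vQ :
        Set ((logShells X logv Aut Ism hAut hIsm).Packet j vQ)) ⊆ D.shellPk j vQ)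
    (hunit : ∀ (m : ℤ) (m' : ℕ) (j : (thetaIndex X).Label) (vQ : (thetaIndex X).VQ),
      C.unitImage m m' j vQ =
        (logShells X logv Aut Ism hAut hIsm).tprodImages j vQ fun v => iterUnits logv Uarc m' v.1)
    (hball : ∀ (m : ℤ) (j : (thetaIndex X).Label) (vQ : (thetaIndex X).VQ),
      C.ballImage m j vQ =
        (logShells X logv Aut Ism hAut hIsm).tprodImages j vQ fun v => shell logv v.1) :
    C.Ind3 D := by
  have hsub : ∀ (m' : ℕ) (vQ : (thetaIndex X).VQ) (v : (thetaIndex X).Fibre vQ),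
      (iterUnits logv Uarc m' v.1 : Set ((logShells X logv Aut Ism hAut hIsm).carrier v.1)) ⊆
        ((logShells X logv Aut Ism hAut hIsm).shellSubgroup v.1 :
          Set ((logShells X logv Aut Ism hAut hIsm).carrier v.1)) :=
    fun m' vQ v => (iterUnits_subset_shell hlaw Uarc hU0 hUs m' v.1).trans
      ((logShells X logv Aut Ism hAut hIsm).shell_subset_shellSubgroup v.1)
  refine C.ind3_of_componentwise D hpk (fun _ m' vQ v => iterUnits logv Uarc m' v.1)
    (fun _ vQ v => shell logv v.1) ?_ ?_ ?_ ?_ hunit hball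
  · exact fun m m' vQ _ v => hsub m' vQ v
  · exact fun m vQ _ v => hsub 0 vQ v
  · exact fun m vQ _ v => (logShells X logv Aut Ism hAut hIsm).shell_subset_shellSubgroup v.1
  · intro m m' hm' vQ _ v
    obtain ⟨k, rfl⟩ : ∃ k, m' = k + 1 := ⟨m' - 1, by omega⟩
    exact iterUnits_succ_subset_shell logv Uarc hUs k v.1

end Column

/-! ## §4 The typed Thm. 3.11 (ii) for the strictified lattice situation over the real carriers -/

namespace Real

open NumberField IsDedekindDomain Literature.IUT.LogVolume Literature.IUT.LogThetaLattice

variable {F : Type} [Field F] [NumberField F]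
variable (X : PilotData F) (logv : PadicLogs F) (Aut Ism : ∀ x : Place F, Set (Carrier x ≃ₗ[ℚ] Carrier x))
  (hAut : ∀ x, LinearEquiv.refl ℚ (Carrier x) ∈ Aut x) (hIsm : ∀ x, LinearEquiv.refl ℚ (Carrier x) ∈ Ism x)
  (Uarc : ℕ → ∀ w : InfinitePlace F, Set (Carrier (.inl w : Place F)))
  (archPk : ∀ (j : (thetaIndex X).Label) (vQ : (thetaIndex X).VQ), Set ((logShells X logv Aut Ism hAut hIsm).Packet j vQ))
  (archSub : ∀ (j : (thetaIndex X).Label) (v : Place F),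
    Set ((logShells X logv Aut Ism hAut hIsm).Packet j ((thetaIndex X).over v)))
  (Adm : ∀ (j : (thetaIndex X).Label) (vQ : (thetaIndex X).VQ), Set ((logShells X logv Aut Ism hAut hIsm).Packet j vQ) → Prop)
  (logvol : ∀ (j : (thetaIndex X).Label) (vQ : (thetaIndex X).VQ), Set ((logShells X logv Aut Ism hAut hIsm).Packet j vQ) → ℝ)
  (Ψ : ℤ → ∀ v : Place F, v ∈ (thetaIndex X).Vbad → Set ((logShells X logv Aut Ism hAut hIsm).StarPacket v))
  (act : ℤ → ∀ v : Place F, v ∈ (thetaIndex X).Vbad → (logShells X logv Aut Ism hAut hIsm).StarPacket v →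
    Module.End ℚ ((logShells X logv Aut Ism hAut hIsm).StarPacket v))
  (Mmod : ℤ → ∀ j : (thetaIndex X).LabelStar, Set ((logShells X logv Aut Ism hAut hIsm).GlobalPacket j.1))
  (region : ℤ → ∀ j : (thetaIndex X).LabelStar,
    FinDivisor F → ∀ vQ : (thetaIndex X).VQ, Set ((logShells X logv Aut Ism hAut hIsm).Packet j.1 vQ))
  (thetaDiv₀ : ℤ → ℤ → LgpDivisor F (thetaIndex X).lstar)

/-- **[IUTchIII] Thm. 3.11 (ii) — the TYPED (ii) (`LatticeSituation.PartII`) HOLDS for "the situation of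
Theorem 3.11" OVER THE REAL CARRIERS in the strictified reading** (abc-iut-c312-5's
`LatticeSituation.ofShells` over `Real.logShells X logv Aut Ism …` with each column's Frobenius-like binders
:= the coric data of its line; the columns' unit-group images := the pure-tensor images of
`Real.iterUnits` — at finite places the images of the iterates of the log-link on the units, DEFINED here —
and radius-`π` balls := the pure-tensor images of the shells), given: the law `O_v ⊆ I_v` on the logarithm
binder, the archimedean binder `Uarc` starting at `{‖a‖ = 1}` and staying in the ball, and the archimedean
integral-structure binder `archPk` containing the pure tensors of shell elements. Route: c312-5's
`LatticeSituation.partII_iff_ind3_of_coric` ((ii) ⟺ (Ind3) in the strictified reading) and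
`Column.ind3_logShells_of_iterUnits`. HONEST FRAMING: module docstring. [claim: Mochizuki2012, status: disputed] -/
theorem partII_ofShells_of_iterUnits (hlaw : LogvLaw logv)
    (hU0 : ∀ w, Uarc 0 w = unitsSet (.inl w : Place F))
    (hUs : ∀ k w, Uarc (k + 1) w ⊆ shell logv (.inl w))
    (harch : ∀ (j : (thetaIndex X).Label) (vQ : (thetaIndex X).VQ), ¬ (thetaIndex X).IsNon vQ →
      ((logShells X logv Aut Ism hAut hIsm).shellPk j vQ :
        Set ((logShells X logv Aut Ism hAut hIsm).Packet j vQ)) ⊆ archPk j vQ) :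
    (LatticeSituation.ofShells (logShells X logv Aut Ism hAut hIsm) F archPk archSub Adm logvol Ψ act Mmod
        region (fun _ _ => Adm) (fun _ _ => logvol) (fun n _ => Ψ n) (fun n _ => Mmod n)
        (fun _ _ m' j vQ =>
          (logShells X logv Aut Ism hAut hIsm).tprodImages j vQ fun v => iterUnits logv Uarc m' v.1)
        (fun _ _ j vQ => (logShells X logv Aut Ism hAut hIsm).tprodImages j vQ fun v => shell logv v.1)
        thetaDiv₀).PartII := by
  refine (LatticeSituation.partII_iff_ind3_of_coric (logShells X logv Aut Ism hAut hIsm) F archPk archSub Adm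
    logvol Ψ act Mmod region _ _ thetaDiv₀).mpr fun n => ?_
  refine Column.ind3_logShells_of_iterUnits X logv hlaw Aut Ism hAut hIsm Uarc hU0 hUs _ _ (fun j vQ => ?_)
    (fun _ _ _ _ => rfl) (fun _ _ _ => rfl)
  show ((logShells X logv Aut Ism hAut hIsm).shellPk j vQ : Set _) ⊆
    (MRData.ofShells (logShells X logv Aut Ism hAut hIsm) archPk archSub Adm logvol (Ψ n) (act n)
      (Mmod n)).shellPk j vQ
  by_cases hv : (thetaIndex X).IsNon vQ
  · rw [MRData.ofShells_shellPk_of_isNon _ archPk archSub Adm logvol (Ψ n) (act n) (Mmod n) hv]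
  · rw [MRData.ofShells_shellPk_of_not_isNon _ archPk archSub Adm logvol (Ψ n) (act n) (Mmod n) hv]
    exact harch j vQ hv

end Real

namespace Real

open NumberField IsDedekindDomain Literature.IUT.LogVolume Literature.IUT.LogThetaLattice
variable {F : Type} [Field F] [NumberField F]
variable (X : PilotData F) (Aut Ism : ∀ x : Place F, Set (Carrier x ≃ₗ[ℚ] Carrier x))
  (hAut : ∀ x, LinearEquiv.refl ℚ (Carrier x) ∈ Aut x) (hIsm : ∀ x, LinearEquiv.refl ℚ (Carrier x) ∈ Ism x)
  (Uarc : ℕ → ∀ w : InfinitePlace F, Set (Carrier (.inl w : Place F)))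
  (archPk : ∀ (j : (thetaIndex X).Label) (vQ : (thetaIndex X).VQ),
    Set ((logShells X (analyticLogv F) Aut Ism hAut hIsm).Packet j vQ))
  (archSub : ∀ (j : (thetaIndex X).Label) (v : Place F),
    Set ((logShells X (analyticLogv F) Aut Ism hAut hIsm).Packet j ((thetaIndex X).over v)))
  (Adm : ∀ (j : (thetaIndex X).Label) (vQ : (thetaIndex X).VQ),
    Set ((logShells X (analyticLogv F) Aut Ism hAut hIsm).Packet j vQ) → Prop)
  (logvol : ∀ (j : (thetaIndex X).Label) (vQ : (thetaIndex X).VQ),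
    Set ((logShells X (analyticLogv F) Aut Ism hAut hIsm).Packet j vQ) → ℝ)
  (Ψ : ℤ → ∀ v : Place F, v ∈ (thetaIndex X).Vbad →
    Set ((logShells X (analyticLogv F) Aut Ism hAut hIsm).StarPacket v))
  (act : ℤ → ∀ v : Place F, v ∈ (thetaIndex X).Vbad →
    (logShells X (analyticLogv F) Aut Ism hAut hIsm).StarPacket v →
      Module.End ℚ ((logShells X (analyticLogv F) Aut Ism hAut hIsm).StarPacket v))
  (Mmod : ℤ → ∀ j : (thetaIndex X).LabelStar,
    Set ((logShells X (analyticLogv F) Aut Ism hAut hIsm).GlobalPacket j.1))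
  (region : ℤ → ∀ j : (thetaIndex X).LabelStar, FinDivisor F → ∀ vQ : (thetaIndex X).VQ,
    Set ((logShells X (analyticLogv F) Aut Ism hAut hIsm).Packet j.1 vQ))
  (thetaDiv₀ : ℤ → ℤ → LgpDivisor F (thetaIndex X).lstar)

/-- **Thm. 3.11 (ii) for the strictified real lattice situation, UNCONDITIONAL IN THE LOGARITHM**: at the
ANALYTIC `p_v`-adic logarithms `logv := Real.analyticLogv F` (abc-iut-S1's `unitLog` in abc-iut-S7's rescaled
completions; the law `O_v ⊆ I_v` is abc-iut-c312-5's `logvLaw_analyticLogv`), `LatticeSituation.PartII`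
holds given only the archimedean binder conditions. [claim: Mochizuki2012, status: disputed] -/
theorem partII_ofShells_analyticLogv
    (hU0 : ∀ w, Uarc 0 w = unitsSet (.inl w : Place F))
    (hUs : ∀ k w, Uarc (k + 1) w ⊆ shell (analyticLogv F) (.inl w))
    (harch : ∀ (j : (thetaIndex X).Label) (vQ : (thetaIndex X).VQ), ¬ (thetaIndex X).IsNon vQ →
      ((logShells X (analyticLogv F) Aut Ism hAut hIsm).shellPk j vQ :
        Set ((logShells X (analyticLogv F) Aut Ism hAut hIsm).Packet j vQ)) ⊆ archPk j vQ) :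
    (LatticeSituation.ofShells (logShells X (analyticLogv F) Aut Ism hAut hIsm) F archPk archSub Adm logvol Ψ
        act Mmod region (fun _ _ => Adm) (fun _ _ => logvol) (fun n _ => Ψ n) (fun n _ => Mmod n)
        (fun _ _ m' j vQ =>
          (logShells X (analyticLogv F) Aut Ism hAut hIsm).tprodImages j vQ fun v =>
            iterUnits (analyticLogv F) Uarc m' v.1)
        (fun _ _ j vQ =>
          (logShells X (analyticLogv F) Aut Ism hAut hIsm).tprodImages j vQ fun v =>
            shell (analyticLogv F) v.1)
        thetaDiv₀).PartII :=
  partII_ofShells_of_iterUnits X (analyticLogv F) Aut Ism hAut hIsm Uarc archPk archSub Adm logvol Ψ act Mmod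
    region thetaDiv₀ (logvLaw_analyticLogv F) hU0 hUs harch

end Real

end Summit.ABC.IUTFork.Thm311

end
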